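import Literature.Probability.RandomPlanarGeometry.SLEMarkovKernelIdentify
import Literature.Probability.RandomPlanarGeometry.SLETraceHittingMarkov
import Literature.Probability.RandomPlanarGeometry.CurveClassStopAtMeasurable
import Literature.Probability.RandomPlanarGeometry.SLEExistenceConverse
import HarnessLib

/-!
# The domain Markov property of chordal SLE_κ (typed form)

Topic `Probability/RandomPlanarGeometry`; theorems (crux `stmt-CriticalPhenomena-0698`, closes stub
`stub_isDomainMarkov` of line `germ-label-transport` for every `κ > 0`).

* `measure_preimage_surgery_eq_lintegral_gval` — the disintegration identity on the canonical
  space: `P (Γ ∈ stopAt F⁻¹ S ∩ startFrom F⁻¹ T) = ∫⁻ gval ∘ Γ dP` for a measurable version `Γ` of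
  the SLE curve described through `φ` (split along `{F never hit}`; on `{F hit}` the freezing
  formula `setIntegral_sleTraceAfter_hitting_eq_setIntegral_integral_continuousMap` with the test
  functional `markovFz`);
* `sleMarkovKernel_markov` — the `markov` clause of `ChordalFamily.IsMarkovExtension` for the
  kernel `sleMarkovKernel κ` and any family of chordal SLE_κ laws;
* **`ChordalFamily.isDomainMarkov_of_isSLELaw`** — every family `Q` of chordal SLE_κ laws on
  Dobrushin domains (`∀ D, IsSLELaw κ D (Q D)`, `0 < κ`) is domain Markov
  (`ChordalFamily.IsDomainMarkov`), with Markov extension `sleMarkovKernel κ`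
  (`initial`: `sleMarkovKernel_initial`; `domain`: `sleMarkovKernel_domain`).

References: W. Werner (2007), §3.2 (2); O. Schramm (2000), §1; G. F. Lawler (2005), §6.2–6.3;
S. Rohde, O. Schramm (2005), §7.
-/

noncomputable section

open Set Filter Topology MeasureTheory ProbabilityTheory Complex
open UpperHalfPlane (upperHalfPlaneSet isOpen_upperHalfPlaneSet)
open scoped NNReal ENNReal unitInterval

namespace Literature.Probability.RandomPlanarGeometry

/-! ### The `markov` clause on the canonical space -/

section MarkovMain

open scoped PathBorel

variable {κ : ℝ≥0} {D : DobrushinDomain} {φ : ConformalEquiv upperHalfPlaneSet D.carrier}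

/-- **The disintegration identity on the canonical space** (for a measurable version of the SLE
curve, a.s. described through `φ`): `P (Γ ∈ stopAt F ⁻¹ S ∩ startFrom F ⁻¹ T) = ∫⁻ gval ∘ Γ dP`.
Proof: split along `{F never hit}` (deterministic surgery) and `{F hit}` (freezing formula at
the trace hitting time with the test functional `markovFz`, identified pathwise with the surgery
event on the left and with `gval` on the right). [cite: Werner2007, §3.2] -/
theorem measure_preimage_surgery_eq_lintegral_gval (h0 : HasSLETrace κ) (hκ : 0 < κ)
    (htr' : ∀ᵐ ω ∂Process.preWienerMeasure, Tendsto (fun t ↦ ‖sleTrace κ ω t‖) atTop atTop) (hφ : D.IsChordalUniformizing φ) {F : Set ℂ}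
    (hF : IsClosed F) {S T : Set (CurveClass ℂ)} (hS : MeasurableSet S) (hT : MeasurableSet T)
    (hST : MeasurableSet (CurveClass.stopAt F ⁻¹' S ∩ CurveClass.startFrom F ⁻¹' T))
    {Γ : (ℝ≥0 → ℝ) → CurveClass ℂ} (hΓm : Measurable Γ)
    (hdesc : ∀ᵐ ω ∂Process.preWienerMeasure, IsLoewnerDescribed φ (Γ ω) (sleDriving κ ω)) :
    Process.preWienerMeasure (Γ ⁻¹' (CurveClass.stopAt F ⁻¹' S ∩ CurveClass.startFrom F ⁻¹' T)) =
      ∫⁻ ω, gval κ φ F S T (Γ ω) ∂Process.preWienerMeasure := by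
  classical
  haveI := isProbabilityMeasure_preWienerMeasure'
  set P : Measure (ℝ≥0 → ℝ) := Process.preWienerMeasure with hP
  set A : Set ℂ := Φp φ ⁻¹' F with hA
  have hAc : IsClosed A := isClosed_preimage_Φp hF
  set τ : (ℝ≥0 → ℝ) → WithTop ℝ≥0 := hittingAfter (fun t ω ↦ sleTrace κ ω t) A 0 with hτdef
  set E : Set (ℝ≥0 → ℝ) := Γ ⁻¹' (CurveClass.stopAt F ⁻¹' S ∩ CurveClass.startFrom F ⁻¹' T)
    with hE
  have hEm : MeasurableSet E := hΓm hST
  set B : Set (ℝ≥0 → ℝ) := {ω | traceHitTime φ A (Γ ω) = ⊤} with hB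
  have hτm : Measurable fun ω ↦ traceHitTime φ A (Γ ω) := (measurable_traceHitTime hφ hAc).comp hΓm
  have hBm : MeasurableSet B := hτm (measurableSet_singleton _)
  have hg : Measurable fun ω ↦ gval κ φ F S T (Γ ω) := (measurable_gval hφ h0 hF hS hT).comp hΓm
  -- the good event
  have hgood : ∀ᵐ ω ∂P, IsLoewnerDescribed φ (Γ ω) (sleDriving κ ω) ∧
      Tendsto (fun t ↦ ‖sleTrace κ ω t‖) atTop atTop ∧
      ∀ r : ℝ≥0, τ ω = r →
        Loewner.IsGeneratedByCurve (sleDrivingAfter κ τ ω) (sleTraceAfter κ τ ω) ∧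
        ∀ u : ℝ≥0, sleTrace κ ω (r + u) =
          extendFrom upperHalfPlaneSet (Loewner.loewnerInv (sleDriving κ ω) r)
            (sleTraceAfter κ τ ω u + sleDriving κ ω r) := by
    have hii := ae_sleTrace_add_eq_extendFrom_hitting h0 hκ hAc
    dsimp only at hii
    filter_upwards [hdesc, (htr' : ∀ᵐ ω ∂P, Tendsto (fun t ↦ ‖sleTrace κ ω t‖) atTop atTop), hii]
      with ω h1 h2 h3
    exact ⟨h1, h2, h3⟩
  -- Term 1: `F` never hit
  have h1 : P (E ∩ B) = ∫⁻ ω in B, gval κ φ F S T (Γ ω) ∂P := by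
    rw [← Measure.restrict_apply' hBm, ← lintegral_indicator_one hEm]
    refine lintegral_congr_ae ((ae_restrict_iff' hBm).2 ?_)
    filter_upwards [hgood] with ω hω hωB
    obtain ⟨hgen, -, -, htrace, c', hc', himg⟩ := markov_goodSpec (κ := κ) hφ hω.1 A
    have htrω := hω.2.1
    have hfull := eq_mk_fullCurve_of_isLoewnerDescribed hφ hgen hc' himg htrω
    have hBω : traceHitTime φ A (Γ ω) = ⊤ := hωB
    have hnever : ∀ s, φ.boundaryExtension (sleTrace κ ω s) ∉ F := fun s h ↦
      trace_notMem_of_traceHitTime_eq_top hBω s (by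
        rw [htrace s, hA, mem_preimage, Φp_eq_of_im_nonneg φ (hgen.im_nonneg s)]; exact h)
    obtain ⟨hstop, hstart⟩ := stopAt_startFrom_fullCurve_of_forall_notMem hφ hgen htrω hF hnever
    rw [gval_eq_of_traceHitTime_eq_top S T hBω]
    simp only [indicator_apply, Pi.one_apply, hE, mem_preimage, mem_inter_iff]
    rw [hfull, hstop, hstart]
    by_cases hS' : CurveClass.mk (fullCurve hφ hgen htrω) ∈ S <;>
      by_cases hT' : CurveClass.mk (Curve.const (D.pt 1)) ∈ T <;> simp [hS', hT']
  -- Term 2: `F` hit at a finite time, via the freezing formula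
  have h2 : P (E ∩ Bᶜ) = ∫⁻ ω in Bᶜ, gval κ φ F S T (Γ ω) ∂P := by
    have hfreeze := setIntegral_sleTraceAfter_hitting_eq_setIntegral_integral_continuousMap h0 hκ
      hAc (measurable_uncurry_markovFz (φ := φ) hS hT)
      (fun x γ' ↦ abs_markovFz_le_one (φ := φ) S T x γ')
    dsimp only at hfreeze
    change ∫ ω in {ω | τ ω ≠ ⊤}, markovFz φ S T (slePast κ τ ω) (sleTraceAfter κ τ ω) ∂P =
      ∫ ω in {ω | τ ω ≠ ⊤}, (∫ ω', markovFz φ S T (slePast κ τ ω) (sleTrace κ ω') ∂P) ∂P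
      at hfreeze
    have hsets : ({ω | τ ω ≠ ⊤} : Set (ℝ≥0 → ℝ)) =ᵐ[P] (Bᶜ : Set (ℝ≥0 → ℝ)) := by
      refine Filter.eventuallyEq_set.2 ?_
      filter_upwards [hgood] with ω hω
      obtain ⟨-, -, hτeq, -⟩ := markov_goodSpec (κ := κ) hφ hω.1 A
      simp only [hB, mem_setOf_eq, mem_compl_iff]
      rw [show τ ω = traceHitTime φ A (Γ ω) from hτeq]
    rw [setIntegral_congr_set hsets, setIntegral_congr_set hsets] at hfreeze
    -- pointwise identifications at a good `ω ∈ Bᶜ`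
    have hptw : ∀ ω, (IsLoewnerDescribed φ (Γ ω) (sleDriving κ ω) ∧
        Tendsto (fun t ↦ ‖sleTrace κ ω t‖) atTop atTop ∧
        ∀ r : ℝ≥0, τ ω = r →
          Loewner.IsGeneratedByCurve (sleDrivingAfter κ τ ω) (sleTraceAfter κ τ ω) ∧
          ∀ u : ℝ≥0, sleTrace κ ω (r + u) =
            extendFrom upperHalfPlaneSet (Loewner.loewnerInv (sleDriving κ ω) r)
              (sleTraceAfter κ τ ω u + sleDriving κ ω r)) → ω ∈ Bᶜ →
        markovFz φ S T (slePast κ τ ω) (sleTraceAfter κ τ ω) = E.indicator (fun _ ↦ (1 : ℝ)) ω ∧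
          ∫ ω', markovFz φ S T (slePast κ τ ω) (sleTrace κ ω') ∂P =
            (gval κ φ F S T (Γ ω)).toReal := by
      intro ω hω hωB
      obtain ⟨hgen, heqW, hτeq, htrace, c', hc', himg⟩ := markov_goodSpec (κ := κ) hφ hω.1 A
      have htrω := hω.2.1
      have hWc : Continuous (sleDriving κ ω) := continuous_sleDriving κ ω
      have hfull := eq_mk_fullCurve_of_isLoewnerDescribed hφ hgen hc' himg htrω
      have hne : traceHitTime φ A (Γ ω) ≠ ⊤ := hωB
      obtain ⟨r, hr'⟩ := WithTop.ne_top_iff_exists.1 hne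
      have hτr : traceHitTime φ A (Γ ω) = r := hr'.symm
      have hτω : τ ω = r := hτeq.trans hτr
      have hmemA : ∀ s, Loewner.trace (drivingFunction φ (Γ ω)) s ∈ A ↔
          φ.boundaryExtension (sleTrace κ ω s) ∈ F := fun s ↦ by
        rw [htrace s, hA, mem_preimage, Φp_eq_of_im_nonneg φ (hgen.im_nonneg s)]
      have hhit : φ.boundaryExtension (sleTrace κ ω r) ∈ F :=
        (hmemA r).1 (trace_mem_of_traceHitTime_eq hAc hτr)
      have hbefore : ∀ s < r, φ.boundaryExtension (sleTrace κ ω s) ∉ F := fun s hs h ↦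
        trace_notMem_of_lt_traceHitTime (by rw [hτr]; exact_mod_cast hs) ((hmemA s).2 h)
      obtain ⟨hgenA, hshift⟩ := hω.2.2 r hτω
      have hγa : ∀ u, 0 ≤ (sleTraceAfter κ τ ω u).im := fun u ↦ hgenA.im_nonneg u
      have hshift' : ∀ u, sleTrace κ ω (r + u) =
          Loewner.bdryInv (sleDriving κ ω) r (sleTraceAfter κ τ ω u + sleDriving κ ω r) := hshift
      have hx2 : (slePast κ τ ω).2 = (r : WithTop ℝ≥0) := hτω
      have hx1 : ∀ s, s ≤ r → (slePast κ τ ω).1 s = sleDriving κ ω s := by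
        intro s hs
        change sleDriving κ ω (min s ((τ ω).untopD 0)) = _
        rw [hτω, WithTop.untopD_coe, min_eq_left hs]
      refine ⟨?_, ?_⟩
      · rw [markovFz_eq_of_hit hφ hWc hgen htrω hF hhit hbefore hγa hshift' hx2 hx1 S T hfull]
        simp only [indicator_apply, hE, mem_preimage]
      · rw [integral_markovFz_sleTrace_eq hφ hWc hgen h0 hx2 hx1 S hT,
          gval_eq_of_traceHitTime_eq hφ hWc hgen heqW S T hτr]
    have hL : ∫ ω in Bᶜ, markovFz φ S T (slePast κ τ ω) (sleTraceAfter κ τ ω) ∂P =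
        P.real (E ∩ Bᶜ) := by
      rw [← measureReal_restrict_apply hEm, ← integral_indicator_one hEm]
      refine integral_congr_ae ((ae_restrict_iff' hBm.compl).2 ?_)
      filter_upwards [hgood] with ω hω hωB
      exact (hptw ω hω hωB).1
    have hR : ∫ ω in Bᶜ, (∫ ω', markovFz φ S T (slePast κ τ ω) (sleTrace κ ω') ∂P) ∂P =
        (∫⁻ ω in Bᶜ, gval κ φ F S T (Γ ω) ∂P).toReal := by
      rw [← integral_toReal hg.aemeasurable.restrict
        (ae_of_all _ fun ω ↦ (gval_le_one h0 F S T (Γ ω)).trans_lt ENNReal.one_lt_top)]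
      refine integral_congr_ae ((ae_restrict_iff' hBm.compl).2 ?_)
      filter_upwards [hgood] with ω hω hωB
      exact (hptw ω hω hωB).2
    have hfin1 : P (E ∩ Bᶜ) ≠ ⊤ := measure_ne_top _ _
    have hfin2 : ∫⁻ ω in Bᶜ, gval κ φ F S T (Γ ω) ∂P ≠ ⊤ := by
      refine ne_top_of_le_ne_top (measure_ne_top (P.restrict Bᶜ) univ) ?_
      calc ∫⁻ ω in Bᶜ, gval κ φ F S T (Γ ω) ∂P ≤ ∫⁻ _ in Bᶜ, (1 : ℝ≥0∞) ∂P :=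
            lintegral_mono fun ω ↦ gval_le_one h0 F S T (Γ ω)
        _ = (P.restrict Bᶜ) univ := lintegral_one
    rw [hL, hR, measureReal_def] at hfreeze
    exact (ENNReal.toReal_eq_toReal_iff' hfin1 hfin2).1 hfreeze
  -- sum
  calc P E = P (E ∩ B) + P (E \ B) := (measure_inter_add_sdiff₀ E hBm.nullMeasurableSet).symm
    _ = P (E ∩ B) + P (E ∩ Bᶜ) := by rw [Set.sdiff_eq]
    _ = ∫⁻ ω in B, gval κ φ F S T (Γ ω) ∂P + ∫⁻ ω in Bᶜ, gval κ φ F S T (Γ ω) ∂P := by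
      rw [h1, h2]
    _ = ∫⁻ ω, gval κ φ F S T (Γ ω) ∂P := lintegral_add_compl _ hBm

end MarkovMain

/-! ### Assembly: the `markov` clause and the domain Markov property of the SLE_κ family -/

section MarkovAssembly

variable {κ : ℝ≥0}

/-- **The `markov` clause of the SLE Markov kernel**: for a family of chordal SLE_κ laws,
`P_D (stopAt F ∈ S, startFrom F ∈ T) = ∫_{stopAt F ∈ S} K D (stopAt F γ) T dP_D(γ)`.
Proof: write `P_D` as the law of a measurable version of the SLE curve described through the
uniformizer of its definition, evaluate both sides on the canonical space
(`measure_preimage_surgery_eq_lintegral_gval`, `lintegral_indicator_sleMarkovKernel_eq`).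
[cite: Werner2007, §3.2] -/
theorem sleMarkovKernel_markov (hκ : 0 < κ) {Q : ChordalFamily}
    (hQ : ∀ D : DobrushinDomain, IsSLELaw κ D (Q D)) (D : DobrushinDomain) (F : Set ℂ)
    (hF : IsClosed F) (S T : Set (CurveClass ℂ)) (hS : MeasurableSet S) (hT : MeasurableSet T) :
    Q D (CurveClass.stopAt F ⁻¹' S ∩ CurveClass.startFrom F ⁻¹' T) =
      ∫⁻ γ in CurveClass.stopAt F ⁻¹' S, sleMarkovKernel κ D (γ.stopAt F) T ∂(Q D) := by
  obtain ⟨Γ, hΓ, hQD⟩ := hQ D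
  have h0 : HasSLETrace κ := hΓ.hasSLETrace
  have htr := hΓ.ae_tendsto_norm_sleTrace_atTop
  obtain ⟨hΓam, φ, hφ, hae⟩ := hΓ
  have hdesc : ∀ᵐ ω ∂Process.preWienerMeasure, IsLoewnerDescribed φ (Γ ω) (sleDriving κ ω) :=
    hae.mono fun ω hω ↦ ⟨continuous_sleDriving κ ω, sleTrace κ ω, hω.1, hω.2⟩
  -- a measurable modification of the curve
  have hΓ'm : Measurable (hΓam.mk Γ) := hΓam.measurable_mk
  have haeq : Γ =ᵐ[Process.preWienerMeasure] hΓam.mk Γ := hΓam.ae_eq_mk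
  have hlaw : Q D = Process.preWienerMeasure.map (hΓam.mk Γ) := hQD.trans (Measure.map_congr haeq)
  have hdesc' : ∀ᵐ ω ∂Process.preWienerMeasure, IsLoewnerDescribed φ (hΓam.mk Γ ω) (sleDriving κ ω) := by
    filter_upwards [hdesc, haeq] with ω h1 h2
    rwa [← h2]
  have hmS := CurveClass.measurableSet_stopAt_preimage hF hS
  have hmT := CurveClass.measurableSet_startFrom_preimage hF hT
  rw [hlaw, Measure.map_apply hΓ'm (hmS.inter hmT), ← lintegral_indicator hmS,
    measure_preimage_surgery_eq_lintegral_gval h0 hκ htr hφ hF hS hT (hmS.inter hmT) hΓ'm hdesc',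
    lintegral_indicator_sleMarkovKernel_eq hφ h0 htr hF hS hT hΓ'm.aemeasurable
      (hdesc'.mono fun ω h ↦ ⟨_, h⟩)]

/-- **The SLE Markov kernel is a domain-Markov extension of any family of chordal SLE_κ laws**
(`0 < κ`; the family itself witnesses `HasSLETrace κ` and transience). [cite: Werner2007, §3.2] -/
theorem ChordalFamily.isMarkovExtension_sleMarkovKernel (hκ : 0 < κ) {Q : ChordalFamily}
    (hQ : ∀ D : DobrushinDomain, IsSLELaw κ D (Q D)) : Q.IsMarkovExtension (sleMarkovKernel κ) := by
  obtain ⟨Γ, hΓ, -⟩ := hQ DobrushinDomain.unitDisc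
  exact ⟨sleMarkovKernel_initial hΓ.hasSLETrace hΓ.ae_tendsto_norm_sleTrace_atTop hQ,
    fun D F hF S T hS hT ↦ sleMarkovKernel_markov hκ hQ D F hF S T hS hT, sleMarkovKernel_domain κ⟩

/-- **The domain Markov property of chordal SLE_κ** (typed form `ChordalFamily.IsDomainMarkov`):
every family of chordal SLE_κ laws on Dobrushin domains, `0 < κ`, is domain Markov.
[cite: Werner2007, §3.2] -/
theorem ChordalFamily.isDomainMarkov_of_isSLELaw (hκ : 0 < κ) {Q : ChordalFamily}
    (hQ : ∀ D : DobrushinDomain, IsSLELaw κ D (Q D)) : Q.IsDomainMarkov :=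
  ⟨_, ChordalFamily.isMarkovExtension_sleMarkovKernel hκ hQ⟩

end MarkovAssembly

end Literature.Probability.RandomPlanarGeometry

end
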